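import Summits.CriticalPhenomena.CardyFormulaZ2.Theorems.CardyComplexConeDefs
import Literature.Probability.LatticeModels.MedialTrailUmlaufsatz
import Literature.Probability.LatticeModels.InnerFacesHoleFree

/-!
# Corner chains and the winding number of a loop of the turning rule along them
(line `qkz-strip-boundary-arm` of crux `CardyComplexCone.EdgePrecompact`, stmt-CriticalPhenomena-11387;
first file of the stub `stub_vertexRelation`, the `q = 1` half-Cauchy–Riemann vertex relation)

The vertex relation is proved by the edge-flip involution `ω ↦ ω △ {e}`; the only planar input of the
per-pair identity is that a loop `L` of the loop representation spliced into the exploration path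
`γ` at an interior medial vertex (case 1 of `InterfaceRearrangement.lean`) turns by `+2π` when `e`
is closed and by `−2π` when it is open — equivalently, that `γ` lies OUTSIDE `L`: the winding number
of (the medial trail of) `L` vanishes on the medial faces along `γ`. This file supplies the two
generic tools for that statement (next file: `…VertexRelationSpliceLoop.lean`):

* CORNER CHAINS (step relation `fun q q' => ∃ β', q' = nextCorner β' q`, written inline). A chain of coded corners `q₀, q₁, …` in which each `q_{j+1}` is one of the two
  successors of `q_j` under the turning rule (for SOME configuration) is a walk of the oriented medial
  graph (`MedialTrailUmlaufsatz.lean`: `cpos`, `IsDart`). `exists_chain_of_reach`: a chain of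
  side-adjacent faces (a `Relation.ReflTransGen (FaceStep P)` path, `HoleFreePotential.lean`) lifts
  to a corner chain through corners of those faces, from any corner of the last face to any corner of
  the first.
* `chainWinding_eq_zero` (registered sub-goal): along a corner chain avoiding the corners of a cycle
  of the turning rule (minimal period `Q`), whose FIRST corner lies far to the north-west of the cycle
  (in the medial coordinates `(x, y) ↦ (x + y, y − x)`), the winding number of the cycle's closed
  trail vanishes on the two medial faces of every dart of the chain — the vertex-face
  `(v₀ + v₁ − 1, v₁ − v₀)` on its left and the face-face `(g₀ + g₁, g₁ − g₀)` (`g = cFace q`) on its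
  right (`lf_cpos_nextCorner`, `rf_cpos_nextCorner`). Proof: the tube lemma `MedialTrail.tube_chain`
  makes the winding number constant along the chain, and it vanishes above the cycle
  (`MedialTrail.wnd_eq_zero_of_le`).

References: S. Smirnov, Ann. of Math. 172 (2010), §4 and Fig. 5 (the loops of the loop
representation as cycles of the turning rule); G. Grimmett, *The Random-Cluster Model* (2006), §6.1.
-/

namespace Summit.CriticalPhenomena.CardyFormulaZ2.Cruxes.EdgePrecompact.QkzStripBoundaryArm

open MeasureTheory Filter Set Metric
open scoped Topology BigOperators Pointwise
open Literature.Probability.LatticeModels Literature.Probability.Percolation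
open Literature.Probability.RandomPlanarGeometry (DobrushinDomain)
open Summit.CriticalPhenomena.CardyFormulaZ2.Theses.CardyComplexCone

/-! ## The corners of a face and the two kinds of steps -/

/-- Every coded corner is the `q.2`-th corner of its face. -/
theorem eq_cof (q : Site 2 × Fin 4) : q = (cFace q + cornerOff q.2, q.2) :=
  Prod.ext (by simp [cFace, faceAt]) rfl

/-- FOLLOW step inside a face: from the `j`-th corner to the `(j+3)`-rd (= `(j−1)`-st). -/
theorem nextCorner_univ_cof (f : Site 2) (j : Fin 4) :
    nextCorner (Set.univ : BondConfig (Site 2)) (f + cornerOff j, j) = (f + cornerOff (j + 3), j + 3) := by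
  rw [nextCorner_of_mem (Set.mem_univ _)]
  simp only [Prod.mk.injEq, and_true]
  rw [cornerUnit_succ_eq]; abel

/-- CROSS step: from the `j`-th corner of `f` across its source… target edge into the side-adjacent
face `f - cornerUnit j`, arriving at its `(j+1)`-st corner. -/
theorem nextCorner_empty_cof (f : Site 2) (j : Fin 4) :
    nextCorner (∅ : BondConfig (Site 2)) (f + cornerOff j, j) =
      (f - cornerUnit j + cornerOff (j + 1), j + 1) := by
  rw [nextCorner_of_not_mem (Set.notMem_empty _)]
  simp only [Prod.mk.injEq, and_true]
  rw [cornerUnit_eq_off_sub]; abel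

/-- Any two corner indices differ by at most three follow steps. -/
theorem fin4_eq_or (j j' : Fin 4) : j' = j ∨ j' = j + 3 ∨ j' = j + 3 + 3 ∨ j' = j + 3 + 3 + 3 := by
  revert j j'; decide

/-- NAVIGATION inside a face: the `j`-th corner of `f` is joined to its `j'`-th corner by a chain of
at most three follow steps, all through corners of `f`. -/
theorem exists_chain_sameFace (f : Site 2) (j j' : Fin 4) :
    ∃ L : List (Site 2 × Fin 4), L ≠ [] ∧ L.IsChain (fun q q' : Site 2 × Fin 4 => ∃ β' : BondConfig (Site 2), q' = nextCorner β' q) ∧ L.head? = some (f + cornerOff j, j) ∧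
      L.getLast? = some (f + cornerOff j', j') ∧ ∀ q ∈ L, cFace q = f := by
  have step : ∀ i : Fin 4, (fun q q' : Site 2 × Fin 4 => ∃ β' : BondConfig (Site 2), q' = nextCorner β' q)
      (f + cornerOff i, i) (f + cornerOff (i + 3), i + 3) :=
    fun i => ⟨Set.univ, (nextCorner_univ_cof f i).symm⟩
  rcases fin4_eq_or j j' with rfl | rfl | rfl | rfl
  · exact ⟨[(f + cornerOff j', j')], by simp, List.IsChain.singleton _, rfl, rfl,
      by simp [cFace, faceAt_add_cornerOff]⟩
  · exact ⟨[(f + cornerOff j, j), (f + cornerOff (j + 3), j + 3)], by simp,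
      List.isChain_pair.2 (step j), rfl, rfl, by simp [cFace, faceAt_add_cornerOff]⟩
  · exact ⟨[(f + cornerOff j, j), (f + cornerOff (j + 3), j + 3), (f + cornerOff (j + 3 + 3), j + 3 + 3)],
      by simp, List.isChain_cons_cons.2 ⟨step j, List.isChain_pair.2 (step _)⟩, rfl, rfl,
      by simp [cFace, faceAt_add_cornerOff]⟩
  · exact ⟨[(f + cornerOff j, j), (f + cornerOff (j + 3), j + 3), (f + cornerOff (j + 3 + 3), j + 3 + 3),
        (f + cornerOff (j + 3 + 3 + 3), j + 3 + 3 + 3)], by simp,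
      List.isChain_cons_cons.2 ⟨step j, List.isChain_cons_cons.2 ⟨step _, List.isChain_pair.2 (step _)⟩⟩,
      rfl, rfl, by simp [cFace, faceAt_add_cornerOff]⟩

/-- **Lifting a face path to a corner chain.** If the face `b` is reached from `g₀ ∉ P` by side-steps
through faces outside `P`, then every corner of `b` is joined by a corner chain through corners of
faces outside `P` to any prescribed corner of `g₀`. -/
theorem exists_chain_of_reach {P : Set (Site 2)} {g₀ : Site 2} (hg₀ : g₀ ∉ P) (j₁ : Fin 4) {b : Site 2}
    (h : Relation.ReflTransGen (FaceStep P) g₀ b) (j : Fin 4) :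
    ∃ L : List (Site 2 × Fin 4), L ≠ [] ∧ L.IsChain (fun q q' : Site 2 × Fin 4 => ∃ β' : BondConfig (Site 2), q' = nextCorner β' q) ∧ L.head? = some (b + cornerOff j, j) ∧
      L.getLast? = some (g₀ + cornerOff j₁, j₁) ∧ ∀ q ∈ L, cFace q ∉ P := by
  induction h generalizing j with
  | refl =>
    obtain ⟨L, h0, h1, h2, h3, h4⟩ := exists_chain_sameFace g₀ j j₁
    exact ⟨L, h0, h1, h2, h3, fun q hq => by rw [h4 q hq]; exact hg₀⟩
  | @tail b c _ hbc ih =>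
    obtain ⟨i, hi⟩ := exists_eq_add_cornerUnit hbc.1.symm
    obtain ⟨L₁, h10, h11, h12, h13, h14⟩ := exists_chain_sameFace c j (i + 2)
    obtain ⟨L₂, h20, h21, h22, h23, h24⟩ := ih (i + 3)
    refine ⟨L₁ ++ L₂, by simp [h10], List.IsChain.append h11 h21 ?_, ?_, ?_, ?_⟩
    · intro x hx y hy
      rw [h13] at hx; rw [h22] at hy
      simp only [Option.mem_def, Option.some.injEq] at hx hy
      subst hx; subst hy
      refine ⟨∅, ?_⟩
      rw [nextCorner_empty_cof, fin4_add_two_add_one, hi, cornerUnit_add_two, sub_neg_eq_add]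
    · rw [List.head?_append, h12]; rfl
    · rw [List.getLast?_append, h23]; rfl
    · intro q hq
      rcases List.mem_append.1 hq with hq | hq
      · rw [h14 q hq]; exact hbc.2.2
      · exact h24 q hq


/-! ## The two medial faces of a step -/

/-- The medial face on the LEFT of the dart of a corner `q = (v, k)` (whatever its successor): the face
`(v₀ + v₁ − 1, v₁ − v₀)` of the medial lattice around the vertex `v` (the primal vertex is on the left
of every medial edge). -/
theorem lf_cpos_nextCorner (β' : BondConfig (Site 2)) (q : Site 2 × Fin 4) :
    MedialTrail.lf (cpos q, cpos (nextCorner β' q)) = (q.1 0 + q.1 1 - 1, q.1 1 - q.1 0) := by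
  rw [cpos_nextCorner]
  obtain ⟨v, k⟩ := q
  fin_cases k
  all_goals simp (disch := omega) [MedialTrail.lf, cpos, cposOff, cdir, if_neg]
  all_goals omega

/-- The medial face on the RIGHT of the dart of a corner `q`: the face `(g₀ + g₁, g₁ − g₀)` of the
medial lattice inside the primal face `g = cFace q`. -/
theorem rf_cpos_nextCorner (β' : BondConfig (Site 2)) (q : Site 2 × Fin 4) :
    MedialTrail.rf (cpos q, cpos (nextCorner β' q)) =
      ((cFace q) 0 + (cFace q) 1, (cFace q) 1 - (cFace q) 0) := by
  rw [cpos_nextCorner]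
  obtain ⟨v, k⟩ := q
  fin_cases k
  all_goals simp (disch := omega) [MedialTrail.rf, cpos, cposOff, cdir, cFace, faceAt, cornerOff, if_neg]
  all_goals omega

/-- The second medial coordinate of a corner exceeds `v₁ − v₀` by at most one. -/
theorem cposOff_snd_le_one (k : Fin 4) : (cposOff k).2 ≤ 1 := by
  fin_cases k <;> simp [cposOff]

/-- A step of a corner chain which is a dart of the closed trail of a cycle of the turning rule starts
at a corner of that cycle (a dart of the oriented medial graph determines its corner). -/
theorem eq_cornerOrbit_of_dart_mem {β β' : BondConfig (Site 2)} {q₀ q : Site 2 × Fin 4} {Q : ℕ}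
    (hper : cornerOrbit β q₀ Q = q₀)
    (h : (cpos q, cpos (nextCorner β' q)) ∈
      MedialTrail.cdarts ((List.range Q).map fun m => cpos (cornerOrbit β q₀ m))) :
    ∃ m < Q, q = cornerOrbit β q₀ m := by
  have hperP : (fun m => cpos (cornerOrbit β q₀ m)) Q = (fun m => cpos (cornerOrbit β q₀ m)) 0 := by
    simp only [hper]; rfl
  rw [MedialTrail.cdarts_map_range _ hperP, List.mem_map] at h
  obtain ⟨m, hm, hmq⟩ := h
  rw [List.mem_range] at hm
  simp only [Prod.mk.injEq] at hmq
  obtain ⟨h1, h2⟩ := hmq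
  refine ⟨m, hm, ?_⟩
  rw [show cornerOrbit β q₀ (m + 1) = nextCorner β (cornerOrbit β q₀ m) from rfl, cpos_nextCorner,
    cpos_nextCorner, h1, Prod.mk.injEq] at h2
  have hk : (cornerOrbit β q₀ m).2 = q.2 := cdir_injective (Prod.ext (by omega) (by omega))
  exact (eq_of_cpos_eq h1 hk).symm

/-! ## The winding number of a cycle along a corner chain avoiding it -/

/-- **The winding number of a loop of the loop representation vanishes along a corner chain coming
from far away** (registered sub-goal `chainWinding_eq_zero` of stmt-CriticalPhenomena-11387). Let
`q₀` generate a cycle of the turning rule of `β` of minimal period `Q`, and let `full` be a corner chain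
(each corner a successor of the previous one for some configuration) of length `≥ 2`, none of whose
corners lies on the cycle, whose first corner has its face-face above the closed trail of the cycle in
medial coordinates (`B` bounds `v₁ − v₀` over the vertices `v` of the cycle). Then the winding number
of the trail vanishes on both medial faces of every step of the chain. -/
theorem chainWinding_eq_zero : ∀ (β : BondConfig (Site 2)) (q₀ : Site 2 × Fin 4) (Q : ℕ) (full : List (Site 2 × Fin 4)) (B : ℤ), 0 < Q → cornerOrbit β q₀ Q = q₀ → (∀ s, 0 < s → s < Q → cornerOrbit β q₀ s ≠ q₀) → full.IsChain (fun q q' => ∃ β' : BondConfig (Site 2), q' = nextCorner β' q) → 2 ≤ full.length → (∀ q ∈ full, ∀ m, q ≠ cornerOrbit β q₀ m) → (∀ m, (cornerOrbit β q₀ m).1 1 - (cornerOrbit β q₀ m).1 0 ≤ B) → (∀ q ∈ full.head?, B + 2 ≤ (cFace q) 1 - (cFace q) 0) → ∀ (i : ℕ) (hi : i + 1 < full.length), MedialTrail.wnd ((List.range Q).map fun m => cpos (cornerOrbit β q₀ m)) (full[i].1 0 + full[i].1 1 - 1, full[i].1 1 - full[i].1 0) = 0 ∧ MedialTrail.wnd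 ((List.range Q).map fun m => cpos (cornerOrbit β q₀ m)) ((cFace full[i]) 0 + (cFace full[i]) 1, (cFace full[i]) 1 - (cFace full[i]) 0) = 0 := by
  intro β q₀ Q full B hQ hper hmin hchain hlen hoff hB hfar i hi
  set l := (List.range Q).map fun m => cpos (cornerOrbit β q₀ m) with hl
  have htrail := isTrail_cornerOrbit hQ hper hmin
  -- the darts of the walk `full.map cpos`
  have hdarts : ∀ d ∈ MedialTrail.pdarts (full.map cpos), ∃ (j : ℕ) (_ : j + 1 < full.length)
      (β' : BondConfig (Site 2)), d = (cpos full[j], cpos (nextCorner β' full[j])) := by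
    intro d hd
    obtain ⟨j, hj, rfl⟩ := MedialTrail.mem_pdarts_iff.1 hd
    rw [List.length_map] at hj
    obtain ⟨β', hβ'⟩ := hchain.getElem j hj
    exact ⟨j, hj, β', by simp only [List.getElem_map, hβ']⟩
  obtain ⟨a, ha⟩ := MedialTrail.tube_chain htrail.2.2 (full.map cpos) (by rw [List.length_map]; exact hlen)
    (fun d hd => by
      obtain ⟨j, -, β', rfl⟩ := hdarts d hd
      exact isDart_cpos β' _)
    (fun d hd hmem => by
      obtain ⟨j, hj, β', rfl⟩ := hdarts d hd
      obtain ⟨m, -, hm⟩ := eq_cornerOrbit_of_dart_mem hper hmem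
      exact hoff _ (List.getElem_mem _) m hm)
  -- the value `a` at the `j`-th step of the chain
  have hval : ∀ (j : ℕ) (hj : j + 1 < full.length),
      MedialTrail.wnd l (full[j].1 0 + full[j].1 1 - 1, full[j].1 1 - full[j].1 0) = a ∧
      MedialTrail.wnd l ((cFace full[j]) 0 + (cFace full[j]) 1, (cFace full[j]) 1 - (cFace full[j]) 0) = a := by
    intro j hj
    obtain ⟨β', hβ'⟩ := hchain.getElem j hj
    have hmem : (cpos full[j], cpos (nextCorner β' full[j])) ∈ MedialTrail.pdarts (full.map cpos) :=
      MedialTrail.mem_pdarts_iff.2 ⟨j, by rw [List.length_map]; exact hj, by simp only [List.getElem_map, hβ']⟩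
    have := ha _ hmem
    rwa [lf_cpos_nextCorner, rf_cpos_nextCorner] at this
  -- `a = 0`: the face-face of the first corner lies above the trail
  have ha0 : a = 0 := by
    have h0 : 0 + 1 < full.length := by omega
    rw [← (hval 0 h0).2]
    apply MedialTrail.wnd_eq_zero_of_le
    intro P hP
    rw [hl, List.mem_map] at hP
    obtain ⟨m, -, rfl⟩ := hP
    have h1 := hB m
    have h2 := hfar full[0] (by
      rw [Option.mem_def, List.head?_eq_getElem?, List.getElem?_eq_getElem (by omega)])
    have h3 := cposOff_snd_le_one (cornerOrbit β q₀ m).2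
    simp only [cpos]
    omega
  rw [← ha0]
  exact hval i hi

end Summit.CriticalPhenomena.CardyFormulaZ2.Cruxes.EdgePrecompact.QkzStripBoundaryArm
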